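import Summits.QuantumFields.BalabanUV.Beta.EriceRemainderEnclosureHistoryAutonomyComparisonAgeCompositionYoungPairMomentRefinedRows
import Summits.QuantumFields.BalabanUV.Beta.EriceRemainderEnclosureHistoryAutonomyComparisonAgeCompositionYoungPairMomentCoupledRowsB
import Summits.QuantumFields.BalabanUV.Beta.EriceRemainderEnclosureHistoryAutonomyComparisonAgeCompositionYoungPairMomentCoupledRowsC
import Summits.QuantumFields.BalabanUV.Beta.EriceRemainderEnclosureHistoryAutonomyComparisonAgeCompositionYoungPairMomentCoupledRowsD
import Summits.QuantumFields.BalabanUV.Beta.EriceRemainderEnclosureHistoryAutonomyComparisonAgeCompositionThreeAgesFromSeventeen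

/-!
# EriceRemainderEnclosureHistoryAutonomyComparisonAgeCompositionThreeAgesEveryRatio — (E94m) route (N), first order: THE CENSUS THREE AGES AT EVERY RATIO.
# For the profile carried by `{1, k₂, k₃}` with ANY `2 ≤ k₂ < k₃ < K`, along every admissible flow (isotone dominated memory with floor), for every horizon
# `N ≥ K` and every damping of the self-consistent class `g_t(1+F_t) ≥ 1`, the first-order comparison surplus satisfies `0 ≤ ε ≤ e`.  The union of
# (E94e) `flow_nonneg_census_three_ages_middle_le_ten` (`k₂ ≤ 10`), (E94i–l) `flow_nonneg_census_three_ages_middle_eleven … sixteen` (the coupled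
# letters in the gaps, (E90c) below, (E94f∕g) above) and g83's (E93k) `flow_nonneg_census_three_ages_from_seventeen` (`k₂ ≥ 17`) — the target
# «three ages at every ratio» of README g82∕e91 §5, g83 §5–§6, g84 §4(2)

Cell `pub-balaban`, β-function sub-cell, BINDER row D4 «RemainderConst leaves for Bałaban's split» (`HOME/BINDER-OWNERS.md`; owner lineage `b2b-balaban-beta-an4`;
this file by co-owner #2 lineage `b2b-balaban-beta-d4-p2`, generation 84), β-FLOW TEAM duty (1), FREEZE (0) honoured (def-free; nothing restated).

HONEST FRAMING (page 1, verbatim and binding).  *"Discharging BetaPertH makes Bałaban's UV stability UNCONDITIONAL — a real constructive-QFT result; it is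
NOT the continuum limit and NOT the Clay problem."*  THIS FILE DISCHARGES NOTHING OF THE KIND.  Elementary real algebra ∕ real analysis about ABSTRACT
functionals on a box ]0,γ]^ℕ with displayed floors, profiles and signs, and the FIRST-ORDER renewal objects of route (N) built from them — hypotheses of a
census, not facts; the form, signs, ages and moments of Bałaban's (1.22) limit functional are NOT PRINTED ([I] p. 298; GAPS G-t4-U2-1∕-2) and NOT asserted.
Row D4 class UNCHANGED (critical-path width 0; instance 0∕1; D4 DISCHARGE NO DATE).  HONEST DEPENDENCY: continuum YM on T⁴ ⇐ BetaPertH ∧ nine spine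
estimates (0/9 proved); BetaPertH ⇐ (D1) ∧ (D4) ∧ CAP+tail; G-an2-4 gates asym, D1 and NE2/3/4.

NOT CLAIMED: `k₂ = 1` is not a three-age profile (two ages `{1, k₃}`: (E91b) `flow_nonneg_two_ages_all`); horizons `N < K`; arbitrary dampings in `]0,1]`
outside the self-consistent class; four or more loaded ages; anything printed — NOT B12 Thm 2, NOT BetaPertH, NOT continuum, NOT Clay.

WHAT IS PROVED ([folklore]; 0 `def`, 0 sorry).  **`flow_nonneg_census_three_ages_all`**.
-/
noncomputable section
open Finset

namespace Summit.QuantumFields.BalabanUV.Beta.EriceRemainderEnclosureHistoryAutonomyComparisonAgeCompositionThreeAgesEveryRatio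

open Literature.MathematicalPhysics.QuantumFieldTheory.Balaban1983to89
open Literature.MathematicalPhysics.QuantumFieldTheory.Balaban1983to89.T4BetaStationary
open Literature.MathematicalPhysics.QuantumFieldTheory.Balaban1983to89.T4BetaFlowWellPosed
open Summit.QuantumFields.BalabanUV.Beta.EriceRemainderEnclosureHistoryAutonomyComparisonAgeCompositionYoungPairMomentRefinedRows
  (flow_nonneg_census_three_ages_middle_le_ten)
open Summit.QuantumFields.BalabanUV.Beta.EriceRemainderEnclosureHistoryAutonomyComparisonAgeCompositionYoungPairMomentCoupledRowsA
  (flow_nonneg_census_three_ages_middle_eleven flow_nonneg_census_three_ages_middle_twelve)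
open Summit.QuantumFields.BalabanUV.Beta.EriceRemainderEnclosureHistoryAutonomyComparisonAgeCompositionYoungPairMomentCoupledRowsB
  (flow_nonneg_census_three_ages_middle_thirteen flow_nonneg_census_three_ages_middle_fourteen)
open Summit.QuantumFields.BalabanUV.Beta.EriceRemainderEnclosureHistoryAutonomyComparisonAgeCompositionYoungPairMomentCoupledRowsC
  (flow_nonneg_census_three_ages_middle_fifteen)
open Summit.QuantumFields.BalabanUV.Beta.EriceRemainderEnclosureHistoryAutonomyComparisonAgeCompositionYoungPairMomentCoupledRowsD
  (flow_nonneg_census_three_ages_middle_sixteen)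
open Summit.QuantumFields.BalabanUV.Beta.EriceRemainderEnclosureHistoryAutonomyComparisonAgeCompositionThreeAgesFromSeventeen
  (flow_nonneg_census_three_ages_from_seventeen)

variable {B : (ℕ → ℝ) → ℝ} {γ b gIR : ℝ} {L : ℕ → ℝ} {K : ℕ} {h g : ℕ → ℝ}

/-- **THE CENSUS THREE AGES `{1, k₂, k₃}` AT EVERY RATIO.**  `B` an isotone memory on the box with floor `b > 0` dominating the profile `L ≥ 0` carried
by `{1, k₂, k₃}` with `2 ≤ k₂ < k₃ < K` (`L_j = 0` for the other ages `< K`); `h` a box solution; dampings `0 < g ≤ 1` with `g_t(1 + F_t) ≥ 1`; the damped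
tail-sum kernels `KL`, their aggregates `KA` and reads `RA`; horizon `N ≥ K`; `e ≥ 0` non-increasing; `ε` the first-order comparison solution with zero
tail beyond `N`.  THEN `0 ≤ ε ≤ e` at every pin. [folklore] -/
theorem flow_nonneg_census_three_ages_all (hmono : ∀ u v : ℕ → ℝ, SeqBox γ u → SeqBox γ v → (∀ j, u j ≤ v j) → B u ≤ B v)
    (hL : ∀ k, 0 ≤ L k) (hb : 0 < b) (hlo : ∀ u, SeqBox γ u → b ≤ B u) (hdom : ∀ u, SeqBox γ u → ∑ k ∈ range K, L k * u k ≤ B u)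
    (hh : SeqBox γ h) (hf : MemFlow B gIR h) (hg : ∀ t, 0 < g t ∧ g t ≤ 1)
    (hgF : ∀ t, 1 ≤ g t * (1 + ∑ k ∈ range K, L k * h (t + k) ^ 3 / 2))
    {k₂ k₃ : ℕ} (hk2 : 2 ≤ k₂) (hk23 : k₂ < k₃) (hk3K : k₃ < K) (hL3 : ∀ j, j < K → j ≠ 1 → j ≠ k₂ → j ≠ k₃ → L j = 0)
    {N : ℕ} (hKN : K ≤ N) {KL : ℕ → ℕ → ℕ → ℝ}
    (hKL : ∀ k n l, KL k n l = if 0 < k ∧ k < K ∧ l < k then L k * h (n + k) ^ 3 / 2 * ∏ t ∈ Ico (n + 1 + l) (n + k + 1), g t else 0)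
    {KA : ℕ → ℕ → ℕ → ℝ} {RA : ℕ → (ℕ → ℝ) → ℕ → ℝ}
    (hRA : ∀ i v m, RA i v m = ∑ l ∈ range K, KA i m l * v (m + 1 + l))
    (hKA : ∀ i m l, KA i m l = KL i m l + KA (i + 1) m l) (hKAtop : ∀ m l, KA K m l = 0)
    {e ε : ℕ → ℝ} (he0 : ∀ m, 0 ≤ e m) (hea : ∀ m, e (m + 1) ≤ e m)
    (hεt : ∀ m, N < m → ε m = 0) (hεrec : ∀ m, ε m = e m - RA 1 ε m) : ∀ m, 0 ≤ ε m ∧ ε m ≤ e m := by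
  by_cases h10 : k₂ ≤ 10
  · exact flow_nonneg_census_three_ages_middle_le_ten hmono hL hb hlo hdom hh hf hg hgF hk2 h10 hk23 hk3K hL3 hKN hKL hRA hKA hKAtop he0 hea hεt hεrec
  by_cases h17 : 17 ≤ k₂
  · exact flow_nonneg_census_three_ages_from_seventeen hmono hL hb hlo hdom hh hf hg hgF h17 hk23 hk3K hL3 hKN hKL hRA hKA hKAtop he0 hea hεt hεrec
  interval_cases k₂
  · exact flow_nonneg_census_three_ages_middle_eleven hmono hL hb hlo hdom hh hf hg hgF hk23 hk3K hL3 hKN hKL hRA hKA hKAtop he0 hea hεt hεrec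
  · exact flow_nonneg_census_three_ages_middle_twelve hmono hL hb hlo hdom hh hf hg hgF hk23 hk3K hL3 hKN hKL hRA hKA hKAtop he0 hea hεt hεrec
  · exact flow_nonneg_census_three_ages_middle_thirteen hmono hL hb hlo hdom hh hf hg hgF hk23 hk3K hL3 hKN hKL hRA hKA hKAtop he0 hea hεt hεrec
  · exact flow_nonneg_census_three_ages_middle_fourteen hmono hL hb hlo hdom hh hf hg hgF hk23 hk3K hL3 hKN hKL hRA hKA hKAtop he0 hea hεt hεrec
  · exact flow_nonneg_census_three_ages_middle_fifteen hmono hL hb hlo hdom hh hf hg hgF hk23 hk3K hL3 hKN hKL hRA hKA hKAtop he0 hea hεt hεrec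
  · exact flow_nonneg_census_three_ages_middle_sixteen hmono hL hb hlo hdom hh hf hg hgF hk23 hk3K hL3 hKN hKL hRA hKA hKAtop he0 hea hεt hεrec

end Summit.QuantumFields.BalabanUV.Beta.EriceRemainderEnclosureHistoryAutonomyComparisonAgeCompositionThreeAgesEveryRatio

end
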